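import Summits.ValiantsHypothesis.ValiantsHypothesis.Theorems.DepthWindowNodeBias
import Summits.ValiantsHypothesis.ValiantsHypothesis.Theorems.DepthWindowCarrierRound
import Summits.ValiantsHypothesis.ValiantsHypothesis.Theses.DepthWindow
import Summits.ValiantsHypothesis.ValiantsHypothesis.Theorems.SuccinctLiftSmlProduct
import Literature.Computability.AlgebraicComplexity.ArithCircuitProjections
import Mathlib.Data.Complex.Basic
import HarnessLib.Audit.Tags

/-!
# The set-multilinear formula rung under the A-cell, and the linear-tree-bias line

Kernel companion to crux item `HomImmHardTwoOne` (stmt-ValiantsHypothesis-30635) of route `DepthWindow`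
(decomp-valiant lens 4, g18).  The crux asks: homogeneous CIRCUITS of product-depth `2·L₃(m)+c`
(`L₃ = ⌊log₂⌊log₂⌊log₂ m⌋⌋⌋`, degree `d = ⌊√⌊log₂ m⌋⌋`) computing `IMM_{m,d}` have size `> m^c`.  This file
files the strictly-below-the-crux FORMULA rung and its one identified in-family attack:

* `SmlImmFormHardTwoOne` — set-multilinear FORMULAS of product-depth `≤ 2·L₃(m)+c` computing `IMM_{m,d}`
  have more than `m^c + c` wires.  `smlImmFormHardTwoOne_of_homImmHardTwoOne`: the crux implies it
  (a set-multilinear formula, pruned of its empty gates, is a homogeneous circuit with `#gates ≤ #wires`,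
  `ArithCircuit.exists_size_le_edgeSize`).  In print it is OPEN: the strongest bound for set-multilinear
  formulas of product-depth `Γ` in the regime `d ≤ √log n` is superpolynomial only for
  `Γ < log_φ log₂ d ≈ 1.44·log₂log₂ d` [BhargavDuttaSaxena2024, Thm. 1.4/1.7], and
  `(log n)^{Ω(Γ d^{1/Γ})}` [TavenasLimayeSrinivasan2022, Thm. 1] is polynomial at `Γ = Θ(log log d)`.
* `LinearTreeBiasAt q` — at every depth `Δ ≤ 2·L₃(m)+c+1` some integer word fitting `IMM_{m,d}` has
  depth-`Δ` tree bias `≥ Δ·⌊log₂ m⌋/q` bits (slope `1/q` of a letter per level): the fixed-slope weakening of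
  the refuted growth statement `TreeBiasGrowthAt 2` (`linearTreeBiasAt_of_treeBiasGrowthAt_two`).  It is
  what the tree-bias method needs to prove the FORMULA rung (next item) — and it is FALSE for every `q ≥ 1`:
  `not_linearTreeBiasAt`, from the uniform low TREE-bias theorem `universalLowTreeBiasAt_two` (g16,
  `DepthWindowCarrierRound`: every word with letters and total in `[-h,h]` has, at every depth
  `≥ 2⌊log₂⌊log₂ d⌋⌋ + c₁`, tree bias `≤ B·h`), since fitting words have `h ≤ 2⌊log₂ m⌋` while `Δ → ∞`.
* `smlImmFormHardTwoOne_of_linearTreeBiasAt`: `LinearTreeBiasAt q` (any `q ≥ 1`) together with the print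
  fact `TreeBiasImmFormula` (LST 2022 Thm. 3(1), typed in `DepthWindowTreeBiasBridge`) proves the rung —
  with NO unrolling and NO set-multilinearisation cost, because for formulas a FIXED positive slope already
  gives `n^{Ω(Δ)} = n^{Ω(log log d)}` against `d^{3d}·m^{c+1}` (the circuit crux needs slope `→ ∞`,
  `treeBiasDoor_closed`).  With `not_linearTreeBiasAt` this is the formula analogue of the closed door:
  `formulaTreeBiasDoor_closed` — at the slope-2 window the lopsided relative-rank method with ANY word gives
  set-multilinear FORMULAS only `2^{Treebias/2} ≤ n^{O(B)}`, a polynomial; the exponent window that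
  [BhargavDuttaSaxena2024, Thm. 1.7] leaves for few set sizes (`P_Δ` of size `n^{O(Δγ d^{μ(Δ)})}`, i.e.
  `n^{O(Δ)}` at this depth) is closed in the kernel on the lower-bound side.

So the census cell under the crux reads: rung `SmlImmFormHardTwoOne` — WEAKER (kernel, one direction; no
converse known: formulas → circuits costs `s^{O(Γ)}` by unrolling), OPEN in print beyond hom slope `1.44`,
IDEA-NEEDED: its only in-family attack `LinearTreeBiasAt q ∧ TreeBiasImmFormula` is dead in the kernel
(`not_linearTreeBiasAt`, BARRIER = `universalLowTreeBiasAt_two`).  Nothing here proves the crux or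
`VP ≠ VNP`.

[cite: LimayeSrinivasanTavenas2022, Def. 2, Thm. 3, Thm. 5, Question 1] [cite: BhargavDuttaSaxena2024, Thm. 1.7]
[cite: TavenasLimayeSrinivasan2022, Thm. 1] [cite: AndrewsForbes2022, §6.1] [cite: Burgisser2000, Def. 2.1]
-/

namespace Summit.ValiantsHypothesis.ValiantsHypothesis.Theorems.DepthWindow.TreeBias

open MvPolynomial Literature.Computability.AlgebraicComplexity ArithCircuit
open Summit.ValiantsHypothesis.ValiantsHypothesis.Theorems.DepthWindow.Riffle

/-! ### Empty-gate pruning keeps the set of gate values -/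

/-- The gate values of the pruned circuit are among the gate values of the original one (the pruned
list carries the picked value list, `EmptyGatePruning.gateValues_newGates`). [cite: AndrewsForbes2022, §6.1] -/
theorem gateValues_pruneEmpty_subset {k σ : Type*} [CommSemiring k] (P : ArithCircuit k σ) :
    ∀ g ∈ gateValues P.pruneEmpty.gates, g ∈ gateValues P.gates := by
  intro g hg
  have hs : P.size ≤ P.gates.length := le_rfl
  have h : gateValues P.pruneEmpty.gates =
      EmptyGatePruning.pick P.gates P.size (gateValues P.gates) 0 :=
    EmptyGatePruning.gateValues_newGates hs
  rw [h] at hg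
  unfold EmptyGatePruning.pick at hg
  obtain ⟨j, hj, rfl⟩ := List.mem_map.1 hg
  have hk : EmptyGatePruning.keep P.gates j = true := (List.mem_filter.1 hj).2
  have hjlt : j < (gateValues P.gates).length := by
    rw [gateValues_length]
    by_contra hle
    rw [not_lt] at hle
    rw [EmptyGatePruning.keep_eq_false_of_le hle] at hk
    exact Bool.false_ne_true hk
  rw [List.getD_eq_getElem _ _ hjlt]
  exact List.getElem_mem hjlt

/-! ### The formula rung -/

/-- **`SmlImmFormHardTwoOne`** (the set-multilinear formula rung under the A-cell): for every `c`,
eventually in `m`, every set-multilinear formula (blocks = the `d = ⌊√⌊log₂ m⌋⌋` matrix positions) of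
product-depth `≤ 2·L₃(m) + c` computing `IMM_{m,d}` has more than `m^c + c` wires.  Implied by the crux
`HomImmHardTwoOne` (`smlImmFormHardTwoOne_of_homImmHardTwoOne`); no converse known.  OPEN in print beyond
hom/sml product-depth slope `log_φ 2 ≈ 1.44` in `log₂log₂ d` units. [cite: BhargavDuttaSaxena2024, Thm. 1.7]
[cite: TavenasLimayeSrinivasan2022, Thm. 1] -/
@[conjecture] def SmlImmFormHardTwoOne : Prop :=
  ∀ c : ℕ, ∃ m₀ : ℕ, ∀ m : ℕ, m₀ ≤ m →
    ∀ F : ArithCircuit ℂ (Fin (Nat.sqrt (Nat.log 2 m)) × Fin m × Fin m),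
      IsSmlFormula ℂ (Prod.fst : Fin (Nat.sqrt (Nat.log 2 m)) × Fin m × Fin m → Fin (Nat.sqrt (Nat.log 2 m))) F →
      F.Computes (immPoly m (Nat.sqrt (Nat.log 2 m)) ℂ) →
      F.productDepth ≤ 2 * Nat.log 2 (Nat.log 2 (Nat.log 2 m)) + c → m ^ c + c < F.edgeSize

/-- **The crux implies the formula rung.**  A set-multilinear formula is a circuit with homogeneous gate
values (`IsSetMultilinear.isHomogeneous_card`); pruning its empty gates keeps the polynomial, the gate
values (a sub-list) and does not raise the product depth, and leaves `#gates ≤ #wires ≤` the original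
wire count (`ArithCircuit.exists_size_le_edgeSize`). [cite: AndrewsForbes2022, §6.1] [cite: Burgisser2000, Def. 2.1] -/
theorem smlImmFormHardTwoOne_of_homImmHardTwoOne
    (hA : Summit.ValiantsHypothesis.ValiantsHypothesis.Theses.DepthWindow.HomImmHardTwoOne) :
    SmlImmFormHardTwoOne := by
  intro c
  obtain ⟨m₀, hm₀⟩ := hA c
  refine ⟨m₀, fun m hm F hF hFc hpd => ?_⟩
  have hhom : ∀ g ∈ gateValues F.pruneEmpty.gates, ∃ e : ℕ, g.IsHomogeneous e := fun g hg => by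
    obtain ⟨S, hS⟩ := hF.2 g (gateValues_pruneEmpty_subset F g hg)
    exact ⟨S.card, SuccinctLiftSmlProduct.IsSetMultilinear.isHomogeneous_card _ hS⟩
  have hcomp : F.pruneEmpty.Computes (immPoly m (Nat.sqrt (Nat.log 2 m)) ℂ) := by
    unfold ArithCircuit.Computes at hFc ⊢
    rw [ArithCircuit.eval_pruneEmpty]
    exact hFc
  have hpd' : F.pruneEmpty.productDepth ≤ 2 * Nat.log 2 (Nat.log 2 (Nat.log 2 m)) / 1 + c := by
    rw [Nat.div_one]
    exact F.productDepth_pruneEmpty_le.trans hpd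
  have hD := hm₀ m hm F.pruneEmpty hhom hcomp hpd'
  exact lt_of_lt_of_le hD (F.size_pruneEmpty_le_edgeSize.trans F.edgeSize_pruneEmpty_le)

/-! ### Linear tree bias -/

/-- **`LinearTreeBiasAt q`** (linear tree bias at slope `1/q` of a letter per level, on the slope-2 window):
for every `c`, eventually in `m`, at every depth `Δ ≤ 2·L₃(m) + c + 1` some integer word on
`d = ⌊√⌊log₂ m⌋⌋` letters fitting `IMM_{m,d}` (all prefix overhangs `≤ log₂ m` bits) has depth-`Δ` tree bias
`≥ Δ·⌊log₂ m⌋/q` bits.  The fixed-slope weakening of `TreeBiasGrowthAt 2` (slope `→ ∞`); exactly the input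
the tree-bias method needs for the formula rung (`smlImmFormHardTwoOne_of_linearTreeBiasAt`).  FALSE for
every `q ≥ 1` (`not_linearTreeBiasAt`, from `universalLowTreeBiasAt_two`: tree bias `≤ B·h = O(⌊log₂ m⌋)` at
every depth `≥ 2⌊log₂⌊log₂ d⌋⌋ + c₁`, while `Δ·⌊log₂ m⌋/q → ∞` letters).  `q = 0` is degenerate (`·/0 = 0`).
[cite: LimayeSrinivasanTavenas2022, Def. 2, Thm. 5, Question 1] [cite: BhargavDuttaSaxena2024, Thm. 1.7] -/
@[conjecture] def LinearTreeBiasAt (q : ℕ) : Prop :=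
  ∀ c : ℕ, ∃ m₀ : ℕ, ∀ m : ℕ, m₀ ≤ m →
    ∀ Δ : ℕ, Δ ≤ 2 * Nat.log 2 (Nat.log 2 (Nat.log 2 m)) + c + 1 →
      ∃ (sz : Fin (Nat.sqrt (Nat.log 2 m)) → ℕ) (pos : Fin (Nat.sqrt (Nat.log 2 m)) → Bool),
        (∀ i, 1 ≤ sz i) ∧ (∀ t ≤ Nat.sqrt (Nat.log 2 m), 2 ^ GenWord.overLen sz pos t ≤ m) ∧
        TreeBiasGe (GenWord.wt sz pos) Δ (Δ * Nat.log 2 m / q)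

/-- The linear-tree-bias statements get weaker as the slope `1/q` decreases. [folklore] -/
theorem LinearTreeBiasAt.of_le {q q' : ℕ} (h : LinearTreeBiasAt q) (hq : 0 < q) (hqq' : q ≤ q') :
    LinearTreeBiasAt q' := by
  intro c
  obtain ⟨m₀, hm₀⟩ := h c
  refine ⟨m₀, fun m hm Δ hΔ => ?_⟩
  obtain ⟨sz, pos, hsz, hfit, hTB⟩ := hm₀ m hm Δ hΔ
  exact ⟨sz, pos, hsz, hfit, hTB.mono (Nat.div_le_div_left hqq' hq)⟩

/-- `TreeBiasGrowthAt 2` (slope `→ ∞`, refuted by `not_treeBiasGrowthAt_two`) implies every fixed-slope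
statement `LinearTreeBiasAt q`: the linear statements sit strictly below the closed door. [folklore] -/
theorem linearTreeBiasAt_of_treeBiasGrowthAt_two (q : ℕ) (hG : TreeBiasGrowthAt 2) :
    LinearTreeBiasAt q := by
  intro c
  obtain ⟨m₀, hm₀⟩ := hG c 1
  refine ⟨m₀, fun m hm Δ hΔ => ?_⟩
  obtain ⟨sz, pos, hsz, hfit, hTB⟩ := hm₀ m hm Δ hΔ
  refine ⟨sz, pos, hsz, hfit, hTB.mono ?_⟩
  generalize Nat.log 2 (Nat.log 2 (Nat.log 2 m)) = J at hΔ ⊢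
  calc Δ * Nat.log 2 m / q ≤ Δ * Nat.log 2 m := Nat.div_le_self _ _
    _ ≤ (2 * J + c + 1) * Nat.log 2 m := Nat.mul_le_mul_right _ hΔ
    _ ≤ (2 * (1 * (2 * J + c + 2))) * Nat.log 2 m := Nat.mul_le_mul_right _ (by omega)
    _ = 2 * (1 * (2 * J + c + 2) * Nat.log 2 m) := by ring

/-! ### The linear-tree-bias line to the formula rung -/

/-- `d^(3d) ≤ m^3` when `d·d ≤ ⌊log₂ m⌋` and `m ≠ 0` (`d ≤ 2^d`). [folklore] -/
private theorem pow_three_mul_le_cube {d m : ℕ} (hm : m ≠ 0) (hdd : d * d ≤ Nat.log 2 m) :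
    d ^ (3 * d) ≤ m ^ 3 := by
  calc d ^ (3 * d) ≤ (2 ^ d) ^ (3 * d) := Nat.pow_le_pow_left (Nat.lt_two_pow_self).le _
    _ = 2 ^ (3 * (d * d)) := by rw [← pow_mul]; ring_nf
    _ ≤ 2 ^ (3 * Nat.log 2 m) := Nat.pow_le_pow_right (by norm_num) (Nat.mul_le_mul_left 3 hdd)
    _ = (2 ^ Nat.log 2 m) ^ 3 := by rw [mul_comm, pow_mul]
    _ ≤ m ^ 3 := Nat.pow_le_pow_left (Nat.pow_log_le_self 2 hm) 3

/-- **Linear tree bias proves the formula rung** (modulo the print fact `TreeBiasImmFormula`, LST 2022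
Thm. 3(1)): with a word of depth-`Δ` tree bias `≥ Δ⌊log₂ m⌋/q` bits at `Δ = 2L₃(m)+c`, a set-multilinear
`IMM_{m,d}` formula of product-depth `≤ Δ` and `≤ m^c + c` wires would give
`2^{(c+5)⌊log₂ m⌋} ≤ 2^{τ/2} ≤ d^{3d}·(m^c+c+1) ≤ m^{c+4} < 2^{(c+5)⌊log₂ m⌋}` once `L₃(m) ≥ q(c+5)` and
`⌊log₂ m⌋ ≥ c+4`.  No unrolling, no set-multilinearisation: a FIXED slope suffices for formulas.
[cite: LimayeSrinivasanTavenas2022, Thm. 3] -/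
theorem smlImmFormHardTwoOne_of_linearTreeBiasAt {q : ℕ} (hq : 0 < q) (hL : LinearTreeBiasAt q)
    (hT : TreeBiasImmFormula) : SmlImmFormHardTwoOne := by
  intro c
  obtain ⟨m₁, hm₁⟩ := hL c
  refine ⟨max m₁ (max (2 ^ 2 ^ 2 ^ (q * (c + 5))) (2 ^ (c + 4))), fun m hm => ?_⟩
  have hmm₁ : m₁ ≤ m := le_trans (le_max_left _ _) hm
  have hmT : 2 ^ 2 ^ 2 ^ (q * (c + 5)) ≤ m := le_trans (le_trans (le_max_left _ _) (le_max_right _ _)) hm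
  have hmC : 2 ^ (c + 4) ≤ m := le_trans (le_trans (le_max_right _ _) (le_max_right _ _)) hm
  have hm2 : 2 ≤ m := le_trans (by
    calc (2 : ℕ) = 2 ^ 1 := by norm_num
      _ ≤ 2 ^ (c + 4) := Nat.pow_le_pow_right (by norm_num) (by omega)) hmC
  have hm0 : m ≠ 0 := by omega
  have hLc : c + 4 ≤ Nat.log 2 m := Nat.le_log_of_pow_le (by norm_num) hmC
  have hL₃ : q * (c + 5) ≤ Nat.log 2 (Nat.log 2 (Nat.log 2 m)) :=
    Nat.le_log_of_pow_le (by norm_num)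
      (Nat.le_log_of_pow_le (by norm_num) (Nat.le_log_of_pow_le (by norm_num) hmT))
  have hdd : Nat.sqrt (Nat.log 2 m) * Nat.sqrt (Nat.log 2 m) ≤ Nat.log 2 m := Nat.sqrt_le _
  have hm₁' := hm₁ m hmm₁
  generalize hjg : Nat.log 2 (Nat.log 2 (Nat.log 2 m)) = J at hL₃ hm₁' ⊢
  generalize hdg : Nat.sqrt (Nat.log 2 m) = d at hdd hm₁' ⊢
  intro F hF hFc hpd
  -- the depth and the slope bookkeeping
  have hΔq : 2 * q * (c + 5) ≤ 2 * J + c := by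
    have := Nat.mul_le_mul_left 2 hL₃
    calc 2 * q * (c + 5) = 2 * (q * (c + 5)) := by ring
      _ ≤ 2 * J := this
      _ ≤ 2 * J + c := Nat.le_add_right _ _
  have hΔ1 : 1 ≤ 2 * J + c := by
    have : 0 < 2 * q * (c + 5) := by positivity
    omega
  -- the word at the top depth
  obtain ⟨sz, pos, hsz, hfit, hTB⟩ := hm₁' (2 * J + c) (by omega)
  -- the tree-bias bound for set-multilinear formulas
  have hlow := hT m d (2 * J + c) ((2 * J + c) * Nat.log 2 m / q) sz pos hΔ1 hsz hfit hTB F hF hFc hpd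
  by_contra hsize
  rw [not_lt] at hsize
  -- upper bound
  have h3 : d ^ (3 * d) ≤ m ^ 3 := pow_three_mul_le_cube hm0 hdd
  have hE : F.edgeSize + 1 ≤ m ^ (c + 1) := by
    have hc1 : c < 2 ^ c := Nat.lt_two_pow_self
    have h2c : 2 ^ c ≤ m ^ c := Nat.pow_le_pow_left hm2 c
    calc F.edgeSize + 1 ≤ m ^ c + c + 1 := by omega
      _ ≤ m ^ c + m ^ c := by omega
      _ = 2 * m ^ c := by ring
      _ ≤ m * m ^ c := Nat.mul_le_mul_right _ hm2
      _ = m ^ (c + 1) := by ring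
  have hup : d ^ (3 * d) * (F.edgeSize + 1) ≤ m ^ (c + 4) := by
    calc d ^ (3 * d) * (F.edgeSize + 1) ≤ m ^ 3 * m ^ (c + 1) := Nat.mul_le_mul h3 hE
      _ = m ^ (c + 4) := by ring
  -- lower bound
  have hτ : (c + 5) * Nat.log 2 m ≤ (2 * J + c) * Nat.log 2 m / q / 2 := by
    rw [Nat.le_div_iff_mul_le (by norm_num : 0 < 2), Nat.le_div_iff_mul_le hq]
    calc (c + 5) * Nat.log 2 m * 2 * q = (2 * q * (c + 5)) * Nat.log 2 m := by ring
      _ ≤ (2 * J + c) * Nat.log 2 m := Nat.mul_le_mul_right _ hΔq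
  have hlow' : 2 ^ ((c + 5) * Nat.log 2 m) ≤ m ^ (c + 4) :=
    (Nat.pow_le_pow_right (by norm_num) hτ).trans (hlow.trans hup)
  have hlt : m ^ (c + 4) < 2 ^ ((c + 5) * Nat.log 2 m) := by
    have h1 : m < 2 ^ (Nat.log 2 m + 1) := Nat.lt_pow_succ_log_self (by norm_num) m
    calc m ^ (c + 4) < (2 ^ (Nat.log 2 m + 1)) ^ (c + 4) := Nat.pow_lt_pow_left h1 (by omega)
      _ = 2 ^ ((Nat.log 2 m + 1) * (c + 4)) := by rw [← pow_mul]
      _ ≤ 2 ^ ((c + 5) * Nat.log 2 m) := Nat.pow_le_pow_right (by norm_num) (by nlinarith [hLc])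
  exact absurd hlow' (not_le.mpr hlt)

/-! ### The formula door is closed too -/

/-- **No linear tree bias at the slope-2 window** (any slope `1/q`, `q ≥ 1`): the uniform low TREE-bias
theorem `universalLowTreeBiasAt_two` (constants `B, c₁`) caps the depth-`Δ` tree bias of every word with
letters and total in `[-h, h]` at `B·h` for all `Δ ≥ 2⌊log₂⌊log₂ d⌋⌋ + c₁`; a word fitting `IMM_{m,d}` has
`h ≤ 2⌊log₂ m⌋` (`abs_wt_le`, `abs_sum_wt_le`), and at `c = c₁`, `Δ = 2L₃(m) + c₁ ≥ 2⌊log₂⌊log₂ d⌋⌋ + c₁`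
(`d = ⌊√⌊log₂ m⌋⌋ ≤ ⌊log₂ m⌋`) the demanded `Δ⌊log₂ m⌋/q ≥ 2B⌊log₂ m⌋ + 1` once `L₃(m) ≥ q(2B+1)`.
[cite: LimayeSrinivasanTavenas2022, Prop. 17, Question 1] -/
theorem not_linearTreeBiasAt {q : ℕ} (hq : 0 < q) : ¬ LinearTreeBiasAt q := by
  intro hL
  obtain ⟨B, c₁, hB⟩ := universalLowTreeBiasAt_two
  obtain ⟨m₀, hm₀⟩ := hL c₁
  obtain ⟨m, hmm₀, hm2, hmT⟩ : ∃ m, m₀ ≤ m ∧ 2 ≤ m ∧ 2 ^ 2 ^ 2 ^ (q * (2 * B + 1)) ≤ m :=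
    ⟨max m₀ (max 2 (2 ^ 2 ^ 2 ^ (q * (2 * B + 1)))), le_max_left _ _,
      le_trans (le_max_left _ _) (le_max_right _ _), le_trans (le_max_right _ _) (le_max_right _ _)⟩
  have hL1 : 1 ≤ Nat.log 2 m := Nat.le_log_of_pow_le one_lt_two (by simpa using hm2)
  have hL₃ : q * (2 * B + 1) ≤ Nat.log 2 (Nat.log 2 (Nat.log 2 m)) :=
    Nat.le_log_of_pow_le one_lt_two
      (Nat.le_log_of_pow_le one_lt_two (Nat.le_log_of_pow_le one_lt_two hmT))
  have hΔ : 2 * Nat.log 2 (Nat.log 2 (Nat.sqrt (Nat.log 2 m))) + c₁ ≤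
      2 * Nat.log 2 (Nat.log 2 (Nat.log 2 m)) + c₁ := by
    have h2 : Nat.log 2 (Nat.log 2 (Nat.sqrt (Nat.log 2 m))) ≤ Nat.log 2 (Nat.log 2 (Nat.log 2 m)) :=
      Nat.log_mono_right (Nat.log_mono_right (Nat.sqrt_le_self _))
    omega
  obtain ⟨sz, pos, _hsz, hfit, hTB⟩ := hm₀ m hmm₀ (2 * Nat.log 2 (Nat.log 2 (Nat.log 2 m)) + c₁) (by omega)
  have hwi : ∀ i, |GenWord.wt sz pos i| ≤ ((2 * Nat.log 2 m : ℕ) : ℤ) := fun i => abs_wt_le sz pos hfit i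
  have hws : |∑ i, GenWord.wt sz pos i| ≤ ((2 * Nat.log 2 m : ℕ) : ℤ) :=
    le_trans (abs_sum_wt_le sz pos hfit) (by push_cast; linarith)
  have hT := hB _ (GenWord.wt sz pos) (2 * Nat.log 2 m) hwi hws _ hΔ
  refine hT (hTB.mono ?_)
  generalize Nat.log 2 (Nat.log 2 (Nat.log 2 m)) = X at hL₃ ⊢
  generalize Nat.log 2 m = L at hL1 ⊢
  rw [Nat.le_div_iff_mul_le hq]
  calc (B * (2 * L) + 1) * q ≤ (B * (2 * L) + L) * q := Nat.mul_le_mul_right _ (by omega)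
    _ = (q * (2 * B + 1)) * L := by ring
    _ ≤ (2 * X + c₁) * L := Nat.mul_le_mul_right _ (by omega)

/-- **The formula tree-bias door is closed**: the line `LinearTreeBiasAt q → TreeBiasImmFormula →
SmlImmFormHardTwoOne` can never be fed, for any slope `1/q > 0` — the formula analogue of
`treeBiasDoor_closed`.  At the slope-2 window the lopsided relative-rank method (LST 2022 Thm. 3) certifies
for set-multilinear FORMULAS at most `2^{Treebias/2} ≤ n^{O(1)}`. [cite: LimayeSrinivasanTavenas2022, Thm. 3, Question 1]
[cite: BhargavDuttaSaxena2024, Thm. 1.7] -/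
theorem formulaTreeBiasDoor_closed : ∀ q : ℕ, 0 < q → ¬ LinearTreeBiasAt q :=
  fun _ hq => not_linearTreeBiasAt hq

/-- **The formula cell of record** (conjunction of the two kernel directions): the rung is implied by the
crux, and by linear tree bias (any slope `1/q > 0`) plus LST 2022 Thm. 3(1). [folklore] -/
theorem smlImmFormHardTwoOne_cell {q : ℕ} (hq : 0 < q) :
    (Summit.ValiantsHypothesis.ValiantsHypothesis.Theses.DepthWindow.HomImmHardTwoOne → SmlImmFormHardTwoOne) ∧
    (LinearTreeBiasAt q → TreeBiasImmFormula → SmlImmFormHardTwoOne) :=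
  ⟨smlImmFormHardTwoOne_of_homImmHardTwoOne, smlImmFormHardTwoOne_of_linearTreeBiasAt hq⟩

/-- **The formula cell, closed form**: the rung is implied by the crux; linear tree bias (any slope
`1/q > 0`) plus LST 2022 Thm. 3(1) would imply it; and linear tree bias is false — so on the tree-bias
axis the rung is IDEA-NEEDED, exactly like the crux. [folklore] -/
theorem smlImmFormHardTwoOne_cell_closed {q : ℕ} (hq : 0 < q) :
    (Summit.ValiantsHypothesis.ValiantsHypothesis.Theses.DepthWindow.HomImmHardTwoOne → SmlImmFormHardTwoOne) ∧
    (LinearTreeBiasAt q → TreeBiasImmFormula → SmlImmFormHardTwoOne) ∧ ¬ LinearTreeBiasAt q :=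
  ⟨smlImmFormHardTwoOne_of_homImmHardTwoOne, smlImmFormHardTwoOne_of_linearTreeBiasAt hq,
    not_linearTreeBiasAt hq⟩

end Summit.ValiantsHypothesis.ValiantsHypothesis.Theorems.DepthWindow.TreeBias
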